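import Summits.AtomisticToContinuum.BoseEinsteinCondensation.Theses.BECVortexSheetPeierls
import Literature.Probability.LatticeModels.VillainCurrentGinibre
import HarnessLib

/-!
# Route `BECVortexSheetPeierls`, support item `SliceMonotonicity` (stmt-AtomisticToContinuum-13469)

**GKS-II / Ginibre in current variables for the Villain integer-current model.** For every
Villain current model `P` on the space-time torus `(ℤ/L)³ × ℤ/M` (bondwise stiffness, arbitrary
and anisotropic) and all spatial sites `x, y`, the equal-time worm two-point function of `P`
dominates that of its time-slice-`0` model `P₀ : VillainCurrentModel 3 L 1`,
`P₀.stiffness b = P.stiffness ((b.1.1, 0), b.2)`: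
`P₀.twoPoint (x,0) (y,0) ≤ P.twoPoint (x,0) (y,0)`.

This is the instance `d = 3`, `τ = 0` of the Literature theorem
`Literature.Probability.LatticeModels.VillainCurrentModel.twoPoint_slice_le`
(`Literature/Probability/LatticeModels/VillainCurrentGinibre.lean`), proved there WITHOUT duality or
integrals: the doubling substitution `(J, J') ↦ (J + J', J − J')` and the Gaussian identity
`e^{-m²/2κ} e^{-k²/2κ} = e^{-(m+k)²/4κ} e^{-(m−k)²/4κ}` turn `Z(α)Z(β)` into a sum of products of
parity-class current sums, AM–GM gives Ginibre's inequality `2Z(ρ)Z(σ) ≤ Z(0)(Z(ρ+σ)+Z(ρ−σ))`, and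
resumming over the currents on the deleted bonds gives sub-multigraph monotonicity of `Z(ρ)/Z(0)`
("monotone in the volume", Aizenman–Harel–Peled–Shapiro 2021 Cor. 11.4; Ginibre 1970); the slice
model is the sub-multigraph of spatial slice-`0` bonds plus temporal loops, which cancel.

* `SliceMonotonicity_proof` — the route decl, closing item stmt-AtomisticToContinuum-13469.

References: [Ginibre1970] (plane rotators), [AizenmanHarelPeledShapiro2021, Cor. 11.4],
[FrohlichSpencerKT1981], [WallinEtAl1994, §II].
-/

noncomputable section

namespace Summit.AtomisticToContinuum.BoseEinsteinCondensation.Theorems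

open Literature.Probability.LatticeModels

/-- **Item stmt-AtomisticToContinuum-13469** (`SliceMonotonicity` of route `BECVortexSheetPeierls`):
for all `L, M ≥ 1`, every `P : VillainCurrentModel 3 L M` and all spatial sites `x, y`, the
time-slice-`0` model `⟨fun b => P.stiffness ((b.1.1, 0), b.2), _⟩ : VillainCurrentModel 3 L 1` has
`twoPoint (x,0) (y,0) ≤ P.twoPoint (x,0) (y,0)` — Griffiths' second inequality (Ginibre 1970) for
the Villain model in current variables; the instance `τ = 0` of
`VillainCurrentModel.twoPoint_slice_le` (the slice model there, `P.slice 0`, is this structure by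
definition). [cite: Ginibre1970, plane-rotator example; AizenmanHarelPeledShapiro2021 Cor. 11.4] -/
theorem SliceMonotonicity_proof :
    Summit.AtomisticToContinuum.BoseEinsteinCondensation.Theses.BECVortexSheetPeierls.SliceMonotonicity := by
  unfold Summit.AtomisticToContinuum.BoseEinsteinCondensation.Theses.BECVortexSheetPeierls.SliceMonotonicity
  intro L M _ _ P x y
  exact P.twoPoint_slice_le 0 x y

end Summit.AtomisticToContinuum.BoseEinsteinCondensation.Theorems
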